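/-
Copyright (c) 2026 the pub-hodgecm-mathlib formalisation cell (harness21).  Prover seat hodgecm-mathlib-K2E4-p01 (g3), Track B «K2-LIT» ∕ h413
(stmt-HodgeConjecture-24833), socket #22S road: (GS_v′) OUTRIGHT = ★ F-C2 (K2E4-p07 (g3), p856204) ∘ ★ F-C1 (this seat, p856267).  2026-09-04.
-/
import Summits.HodgeConjecture.HodgeConjecture.Theorems.K2E3CentralGermStructureSplitOfGSP     -- ★ p856204 (K2E4-p07 (g3)): F-C2, (GS^P ∀ F) → (GS_v′)
import Summits.HodgeConjecture.HodgeConjecture.Theorems.K2E3GLTwoCentralGermRamifiedRay        -- ★ p856267 (this seat): F-C1, (GS^P)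
import HarnessLib

/-!
# h413 ∕ Track B «K2-LIT» — (GS_v′) OUTRIGHT: the central germ structure of the canonical stable orbital integrals of `H_v = U(Φ₂) × U(Φ₁)`
# at a SPLIT place (two-term germ on a ramified elliptic ray at the central point `(γ_H)_v`, central value from the constant term, rank two)

Cell `pub/hodgecm-mathlib`, crux H413 = `stmt-HodgeConjecture-24833` (supports-only).  This is the input (GS_v′) of the #22S payer of record
★ p856157 `K2E4WeakMatrixFiniteTransportSplitOfSocketsR.weakMatrixFiniteTransportSplit_of_socketsR : ‹(GS_v′)› → ‹(LIFT_v)› → ‹#22S›`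
(K2E4-p18 (g2) REPORT-22 §3; K2E4-p07 (g3) ED. R), discharged by composing ★ F-C2 `K2E3CentralGermStructureSplitOfGSP.centralGermStructureSplit_of_GSP`
(transport along `j = (cmSplitEquivTwo, cmSplitEquivOne)`) with ★ F-C1 `K2E3GLTwoCentralGermRamifiedRay.exists_ellipticRay_orbitalIntegral_eq_add_mul`
(the GL₂ × GL₁ letter (GS^P), universe-polymorphic, read here at `Type`).  Statement = the conclusion of ★ p856204 VERBATIM (= cand :46 of
`K2/K2E4-p18/g2/sig_K2E4Socket22Inputs.cand.K2E4-p18-g2.lean` with the repaired binder `[νHv.IsHaarMeasure]`, K2E4-r02 BOX 28).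
With this file, #22S ⟸ (LIFT_v) ALONE (F-B, K2E4-p03 (g2)).

HONEST LABEL: HC_CM is proved only modulo the 7 printed citations (2 remaining named inputs: hLiu418 = `stmt-HodgeConjecture-24832`,
h413 = `stmt-HodgeConjecture-24833`) until rung 0 closes; this file is an unconditional local theorem and moves no counter by itself.

## References
* [Rogawski1990] J. D. Rogawski, *Automorphic Representations of Unitary Groups in Three Variables* (1990), §8.1 Props. 8.1.1–8.1.3 pp. 114–116; §4.3 (4.3.1) p. 43.
* [HarishChandra1999AdmissibleDistributions] Harish-Chandra (DeBacker–Sally), *Admissible Invariant Distributions on Reductive p-adic Groups*, AMS ULS 16 (1999), Thm. 3.1.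
* [LabesseLanglands1979] J.-P. Labesse, R. P. Langlands, *L-indistinguishability for SL(2)*, Canad. J. Math. 31 (1979), §2 pp. 7–9.
-/

set_option autoImplicit false
set_option linter.dupNamespace false

noncomputable section

open MeasureTheory Measure NumberField IsDedekindDomain Matrix Polynomial Filter
open Literature.MeasureTheory.Group
open Literature.NumberTheory.Rogawski1990 Literature.NumberTheory.Automorphic Literature.NumberTheory.GaloisRepresentations
open Literature.AlgebraicGeometry.ShimuraVarieties (unitaryGroup hermForm)
open scoped MatrixGroups Topology

namespace Summit.HodgeConjecture.HodgeConjecture.Cruxes.H413.K2E3CentralGermStructureSplit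

set_option maxHeartbeats 1600000 in
set_option synthInstance.maxHeartbeats 400000 in
/-- **(GS_v′) CENTRAL GERM STRUCTURE AT A SPLIT PLACE** (H-side, Δ-free), OUTRIGHT: at a place `v` of `L⁺` split in `L`, for a Haar measure `νHv` on `H_v`
and a canonical orbital measure family `mHv`, and the central point `z_v = (γ_H)_v`, `γ_H = (e₁·1₂, e₂)`, `e₁ ≠ e₂`: there is a ray `γ_n → z_v` of
`G`-regular elements, a sequence `G_n` with infinitely many values and constants `λ ≠ 0, λ′` such that every `φ ∈ C_c^∞(H_v)` has
`Φ^st_H(γ_n, φ) = a(φ) + b(φ)·G_n` for `n ≫ 0` with `φ(z_v) = λ·a(φ) + λ′·b(φ)`, and two test functions have linearly independent germ pairs.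
Proof: ★ F-C2 `centralGermStructureSplit_of_GSP` applied to ★ F-C1 `exists_ellipticRay_orbitalIntegral_eq_add_mul`.
[cite: Rogawski1990, §8.1 Props. 8.1.1–8.1.3 pp. 114–116] [cite: HarishChandra1999AdmissibleDistributions, Thm. 3.1] [cite: LabesseLanglands1979, §2 pp. 7–9] -/
theorem centralGermStructureSplit :
    ∀ (L : Type) [Field L] [NumberField L] [IsCMField L] (v : HeightOneSpectrum (𝓞 ↥(maximalRealSubfield L))),
      ¬ Subsingleton (UnitaryGroup.PlacesOver L v) →
    ∀
      [MeasurableSpace ((UnitaryGroup.cmDatum L 2 (Matrix.of fun i j : Fin 2 => if i.val + j.val + 1 = 2 then (1 : L) else 0)).Local v × (UnitaryGroup.cmDatum L 1 (Matrix.of fun i j : Fin 1 => if i.val + j.val + 1 = 1 then (1 : L) else 0)).Local v)] [BorelSpace ((UnitaryGroup.cmDatum L 2 (Matrix.of fun i j : Fin 2 => if i.val + j.val + 1 = 2 then (1 : L) else 0)).Local v × (UnitaryGroup.cmDatum L 1 (Matrix.of fun i j : Fin 1 => if i.val + j.val + 1 = 1 then (1 : L) else 0)).Local v)]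
      [∀ a : ((UnitaryGroup.cmDatum L 2 (Matrix.of fun i j : Fin 2 => if i.val + j.val + 1 = 2 then (1 : L) else 0)).Local v × (UnitaryGroup.cmDatum L 1 (Matrix.of fun i j : Fin 1 => if i.val + j.val + 1 = 1 then (1 : L) else 0)).Local v),
        MeasurableSpace (((UnitaryGroup.cmDatum L 2 (Matrix.of fun i j : Fin 2 => if i.val + j.val + 1 = 2 then (1 : L) else 0)).Local v × (UnitaryGroup.cmDatum L 1 (Matrix.of fun i j : Fin 1 => if i.val + j.val + 1 = 1 then (1 : L) else 0)).Local v) ⧸ Subgroup.centralizer ({a} : Set ((UnitaryGroup.cmDatum L 2 (Matrix.of fun i j : Fin 2 => if i.val + j.val + 1 = 2 then (1 : L) else 0)).Local v × (UnitaryGroup.cmDatum L 1 (Matrix.of fun i j : Fin 1 => if i.val + j.val + 1 = 1 then (1 : L) else 0)).Local v)))]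
      [∀ a : ((UnitaryGroup.cmDatum L 2 (Matrix.of fun i j : Fin 2 => if i.val + j.val + 1 = 2 then (1 : L) else 0)).Local v × (UnitaryGroup.cmDatum L 1 (Matrix.of fun i j : Fin 1 => if i.val + j.val + 1 = 1 then (1 : L) else 0)).Local v),
        BorelSpace (((UnitaryGroup.cmDatum L 2 (Matrix.of fun i j : Fin 2 => if i.val + j.val + 1 = 2 then (1 : L) else 0)).Local v × (UnitaryGroup.cmDatum L 1 (Matrix.of fun i j : Fin 1 => if i.val + j.val + 1 = 1 then (1 : L) else 0)).Local v) ⧸ Subgroup.centralizer ({a} : Set ((UnitaryGroup.cmDatum L 2 (Matrix.of fun i j : Fin 2 => if i.val + j.val + 1 = 2 then (1 : L) else 0)).Local v × (UnitaryGroup.cmDatum L 1 (Matrix.of fun i j : Fin 1 => if i.val + j.val + 1 = 1 then (1 : L) else 0)).Local v)))]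
      (νHv : Measure ((UnitaryGroup.cmDatum L 2 (Matrix.of fun i j : Fin 2 => if i.val + j.val + 1 = 2 then (1 : L) else 0)).Local v × (UnitaryGroup.cmDatum L 1 (Matrix.of fun i j : Fin 1 => if i.val + j.val + 1 = 1 then (1 : L) else 0)).Local v)) [νHv.IsHaarMeasure] [νHv.IsMulRightInvariant]
      (mHv : OrbitalMeasureFamily ((UnitaryGroup.cmDatum L 2 (Matrix.of fun i j : Fin 2 => if i.val + j.val + 1 = 2 then (1 : L) else 0)).Local v × (UnitaryGroup.cmDatum L 1 (Matrix.of fun i j : Fin 1 => if i.val + j.val + 1 = 1 then (1 : L) else 0)).Local v)),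
      mHv.IsCanonical (IsLocalGRegular L v) νHv →
    ∀ (γH : (UnitaryGroup.cmDatum L 2 (Matrix.of fun i j : Fin 2 => if i.val + j.val + 1 = 2 then (1 : L) else 0)).Rational × (UnitaryGroup.cmDatum L 1 (Matrix.of fun i j : Fin 1 => if i.val + j.val + 1 = 1 then (1 : L) else 0)).Rational) (e₁ e₂ : L), e₁ ≠ e₂ →
      (((γH.1 : unitaryGroup (cmConjRingHom L) (Matrix.of fun i j : Fin 2 => if i.val + j.val + 1 = 2 then (1 : L) else 0)).val : GL (Fin 2) L) : Matrix (Fin 2) (Fin 2) L) = e₁ • (1 : Matrix (Fin 2) (Fin 2) L) →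
      (((γH.2 : unitaryGroup (cmConjRingHom L) (Matrix.of fun i j : Fin 1 => if i.val + j.val + 1 = 1 then (1 : L) else 0)).val : GL (Fin 1) L) : Matrix (Fin 1) (Fin 1) L) 0 0 = e₂ →
    ∃ (γ : ℕ → ((UnitaryGroup.cmDatum L 2 (Matrix.of fun i j : Fin 2 => if i.val + j.val + 1 = 2 then (1 : L) else 0)).Local v × (UnitaryGroup.cmDatum L 1 (Matrix.of fun i j : Fin 1 => if i.val + j.val + 1 = 1 then (1 : L) else 0)).Local v)) (G : ℕ → ℂ) (lam lam' : ℂ),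
      (∀ n, IsLocalGRegular L v (γ n)) ∧
      Tendsto γ atTop (nhds
        ((UnitaryGroup.cmDatum L 2 (Matrix.of fun i j : Fin 2 => if i.val + j.val + 1 = 2 then (1 : L) else 0)).toLocal v ((UnitaryGroup.cmDatum L 2 (Matrix.of fun i j : Fin 2 => if i.val + j.val + 1 = 2 then (1 : L) else 0)).toAdelic γH.1),
          (UnitaryGroup.cmDatum L 1 (Matrix.of fun i j : Fin 1 => if i.val + j.val + 1 = 1 then (1 : L) else 0)).toLocal v ((UnitaryGroup.cmDatum L 1 (Matrix.of fun i j : Fin 1 => if i.val + j.val + 1 = 1 then (1 : L) else 0)).toAdelic γH.2))) ∧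
      (Set.range G).Infinite ∧ lam ≠ 0 ∧
      (∀ φ : ((UnitaryGroup.cmDatum L 2 (Matrix.of fun i j : Fin 2 => if i.val + j.val + 1 = 2 then (1 : L) else 0)).Local v × (UnitaryGroup.cmDatum L 1 (Matrix.of fun i j : Fin 1 => if i.val + j.val + 1 = 1 then (1 : L) else 0)).Local v) → ℂ, IsLocSmooth φ →
        ∃ a b : ℂ, (∀ᶠ n in atTop, stableOrbitalIntegralRel (IsLocalStablyConjH L v) mHv φ (γ n) = a + b * G n) ∧
          φ ((UnitaryGroup.cmDatum L 2 (Matrix.of fun i j : Fin 2 => if i.val + j.val + 1 = 2 then (1 : L) else 0)).toLocal v ((UnitaryGroup.cmDatum L 2 (Matrix.of fun i j : Fin 2 => if i.val + j.val + 1 = 2 then (1 : L) else 0)).toAdelic γH.1),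
          (UnitaryGroup.cmDatum L 1 (Matrix.of fun i j : Fin 1 => if i.val + j.val + 1 = 1 then (1 : L) else 0)).toLocal v ((UnitaryGroup.cmDatum L 1 (Matrix.of fun i j : Fin 1 => if i.val + j.val + 1 = 1 then (1 : L) else 0)).toAdelic γH.2)) = lam * a + lam' * b) ∧
      (∃ (φ₁ φ₂ : ((UnitaryGroup.cmDatum L 2 (Matrix.of fun i j : Fin 2 => if i.val + j.val + 1 = 2 then (1 : L) else 0)).Local v × (UnitaryGroup.cmDatum L 1 (Matrix.of fun i j : Fin 1 => if i.val + j.val + 1 = 1 then (1 : L) else 0)).Local v) → ℂ) (a₁ b₁ a₂ b₂ : ℂ), IsLocSmooth φ₁ ∧ IsLocSmooth φ₂ ∧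
        (∀ᶠ n in atTop, stableOrbitalIntegralRel (IsLocalStablyConjH L v) mHv φ₁ (γ n) = a₁ + b₁ * G n) ∧
        (∀ᶠ n in atTop, stableOrbitalIntegralRel (IsLocalStablyConjH L v) mHv φ₂ (γ n) = a₂ + b₂ * G n) ∧ a₁ * b₂ - a₂ * b₁ ≠ 0) :=
  K2E3CentralGermStructureSplitOfGSP.centralGermStructureSplit_of_GSP fun ν _ _ z c =>
    K2E3GLTwoCentralGermRamifiedRay.exists_ellipticRay_orbitalIntegral_eq_add_mul ν z c

end Summit.HodgeConjecture.HodgeConjecture.Cruxes.H413.K2E3CentralGermStructureSplit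

end
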